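import Mathlib
import Summits.KontsevichZagierPeriods.KontsevichZagierPeriods.Theorems.TorsionLogsNeronTorsionSectorStubTranslationCalculus
import Summits.KontsevichZagierPeriods.KontsevichZagierPeriods.Theorems.TorsionLogsNeronTorsionSectorStubHaarReps
import Summits.KontsevichZagierPeriods.KontsevichZagierPeriods.Theorems.TorsionLogsNeronTorsionSectorStubLogStep
import Summits.KontsevichZagierPeriods.KontsevichZagierPeriods.Theorems.TorsionLogsNeronTorsionSectorStubCornerChartUpperAux
import HarnessLib

/-!
# Stub `stub_upperRegular`, auxiliary file — crux `TorsionLogs.NeronTorsionSector`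
(stmt-KontsevichZagierPeriods-14500), line `registered`, block V3

Real analysis of the UPPER branch `ybp = +√f` of the real Weierstrass cubic
`y² = f(x) = 4x³ − g₂x − g₃` to the right of `x₁`, translated by the algebraic point
`P₁ = (x₁, y₁)` (`y₁ < 0`) in REGULAR CHORD FORM: slope `slp = M(x)/(√f + y₁)`,
`M(x) = 4x² + 4xx₁ + 4x₁² − g₂`, sum point `τp = slp²/4 − x − x₁`, `Y3p = −(√f + slp(τp − x))`,
cocycle potential `Qfp = slp/2 + Y3p/(2τp) − √f/(2x)` (the data of the landed
`stub_translationCalculus` / `stub_dlogPotential` with `ε = +1`). This file proves: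

* `upperReg_cubic_factor` (registered helper): the chord cubic factors over its three abscissae,
  `f(t) − (y₀ + s(t − x₀))² = 4(t − x₀)(t − X)(t − (s²/4 − X − x₀))` identically in `t`;
* `upperReg_M_pos`: `M > 0` on `(e₁, ∞)` (purely algebraically: `f(x) = (x − e₁)q(x)` with `q > 0`
  there and `M − q = 4(x₁ − e₁)(x + x₁ + e₁) > 0`);
* the SIGN LEMMA `upperReg_sign`: evaluating the factorisation at the zero `t₀ ∈ (x₁, x)` of the
  increasing chord line gives `f(t₀) > 0`, whence `τp x > t₀ > x₁` and
  `−Y3p x = ℓ(τp x) = slp·(τp x − t₀) > 0` — no continuity argument is needed;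
* `upperReg_third_ge`: `e₁ ≤` the third abscissa of a chord of two identity-component points
  (the factorisation at `e₁`, `f(e₁) = 0`); `upperReg_Pg_ne`: `Pg ≠ 0` from the norm identity;
* `upperReg_key`: the per-point package on `(x₁, ∞)` (`√f + y₁ > 0`, `slp > 0`, `x₁ < τp`,
  `Y3p = −√f∘τp < 0`, chord relations);
* `upperReg_bounded`: `Qfp` is bounded on `(x₁, x₁ + 1]` through the REGULARISED form
  `2D(Mx − √f·D)/(M² − 4(x + x₁)D²) − √f/(2x)`, `D = √f + y₁` (`upperReg_regularised`), whose
  denominator is `4D²τp > 0` on `(x₁, ∞)` and `M(x₁)² > 0` at `x₁`: continuous on the compact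
  `[x₁, x₁ + 1]`;
* `upperReg_semialg`: `ℚ`-semialgebraicity of all the functions by the closure rules
  (junk-tolerant division `cornerUp_fun_div`, `fun_sqrt`; Bochnak–Coste–Roy Prop. 2.2.6).

References: J. H. Silverman, *The Arithmetic of Elliptic Curves* (2nd ed., 2009), III.2.3;
S. Lang, *Fundamentals of Diophantine Geometry* (1983), Ch. 13 Thm 1.1; J. Bochnak, M. Coste,
M.-F. Roy, *Real Algebraic Geometry* (1998), Prop. 2.2.6.
-/

noncomputable section

-- `Summit.KontsevichZagierPeriods.KontsevichZagierPeriods.…` is the tree's mandated layout (single-conjunct summit).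
set_option linter.dupNamespace false

open Set MvPolynomial
open Literature.NumberTheory.Transcendental Literature.ModelTheory.ExponentialFields

namespace Summit.KontsevichZagierPeriods.KontsevichZagierPeriods.Cruxes.NeronTorsionSector.Translation

/-! ### Algebraic helpers -/

/-- **The chord cubic factors over its three abscissae.** For a point `(x₀, y₀)` of
`y² = 4x³ − g₂x − g₃` and a chord of slope `s` in regular form through it and `(X, Y)`
(`s(Y + y₀) = M(X)`, `Y − y₀ = s(X − x₀)`), identically in `t`:
`f(t) − (y₀ + s(t − x₀))² = 4(t − x₀)(t − X)(t − (s²/4 − X − x₀))`. [cite: SilvermanAEC2009, III.2.3] -/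
theorem upperReg_cubic_factor :
    ∀ {g₂ g₃ x₀ y₀ X Y s : ℝ}, y₀ ^ 2 = 4 * x₀ ^ 3 - g₂ * x₀ - g₃ →
    s * (Y + y₀) = 4 * X ^ 2 + 4 * X * x₀ + 4 * x₀ ^ 2 - g₂ → Y - y₀ = s * (X - x₀) →
    ∀ t : ℝ, 4 * t ^ 3 - g₂ * t - g₃ - (y₀ + s * (t - x₀)) ^ 2
      = 4 * (t - x₀) * (t - X) * (t - (s ^ 2 / 4 - X - x₀)) := by
  intro g₂ g₃ x₀ y₀ X Y s hy₀ hM hch t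
  linear_combination (t - x₀) * (s * hch - hM) - hy₀

/-- **The regularised form of the cocycle potential.** With `M = s·D` (`D ≠ 0`) and
`τ = s²/4 − x − x₁ ≠ 0`: `s/2 − (Y + s(τ − x))/(2τ) = 2D(Mx − YD)/(M² − 4(x + x₁)D²)`
(the right-hand side is regular through `D = 0`). [cite: SilvermanAEC2009, III.2.3] -/
theorem upperReg_regularised {s D Y M x x₁ : ℝ} (hD : D ≠ 0) (hM : M = s * D)
    (hτ : s ^ 2 / 4 - x - x₁ ≠ 0) :
    s / 2 + -(Y + s * (s ^ 2 / 4 - x - x₁ - x)) / (2 * (s ^ 2 / 4 - x - x₁))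
      = 2 * D * (M * x - Y * D) / (M ^ 2 - 4 * (x + x₁) * D ^ 2) := by
  subst hM
  have hden : (s * D) ^ 2 - 4 * (x + x₁) * D ^ 2 = 4 * D ^ 2 * (s ^ 2 / 4 - x - x₁) := by ring
  have hden0 : (s * D) ^ 2 - 4 * (x + x₁) * D ^ 2 ≠ 0 := by
    rw [hden]; exact mul_ne_zero (mul_ne_zero four_ne_zero (pow_ne_zero 2 hD)) hτ
  rw [div_add_div _ _ two_ne_zero (mul_ne_zero two_ne_zero hτ),
    div_eq_div_iff (mul_ne_zero two_ne_zero (mul_ne_zero two_ne_zero hτ)) hden0]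
  ring

/-- **Sign lemma for the upper chord.** On `y² = f(x)` with `f > 0` on `(e₁, ∞)`, a point
`P₁ = (x₁, y₁)` with `x₁ > e₁`, `y₁ < 0`, and a chord of positive slope `s` in regular form through
`P₁` and a point `(x, Y)` with `Y > 0`: the third abscissa `τ = s²/4 − x − x₁` lies to the right
of `x₁` and the line is positive there, `Y + s(τ − x) > 0`. Proof: at the zero `t₀` of the line,
`f(t₀) = 4(t₀ − x₁)(t₀ − x)(t₀ − τ) > 0` with `t₀ − x₁ > 0 > t₀ − x`.
[cite: SilvermanAEC2009, III.2.3] -/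
theorem upperReg_sign {g₂ g₃ e₁ x₁ y₁ x Y s : ℝ} {f : ℝ → ℝ}
    (hf : ∀ t, f t = 4 * t ^ 3 - g₂ * t - g₃)
    (hfpos : ∀ t, e₁ < t → 0 < f t) (hx₁ : e₁ < x₁) (hy₁ : y₁ ^ 2 = f x₁) (hy₁neg : y₁ < 0)
    (hY : 0 < Y) (hs : 0 < s)
    (hM : s * (Y + y₁) = 4 * x ^ 2 + 4 * x * x₁ + 4 * x₁ ^ 2 - g₂) (hch : Y - y₁ = s * (x - x₁)) :
    x₁ < s ^ 2 / 4 - x - x₁ ∧ 0 < Y + s * (s ^ 2 / 4 - x - x₁ - x) := by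
  obtain ⟨t₀, ht₀⟩ : ∃ t₀ : ℝ, s * t₀ = s * x₁ - y₁ := ⟨x₁ - y₁ / s, by field_simp⟩
  have hline : y₁ + s * (t₀ - x₁) = 0 := by linear_combination ht₀
  have h1 : 0 < t₀ - x₁ := by
    have h : s * (t₀ - x₁) = -y₁ := by linear_combination ht₀
    have h' : 0 < s * (t₀ - x₁) := by rw [h]; linarith
    exact pos_of_mul_pos_right h' hs.le
  have h2 : t₀ - x < 0 := by
    have h : s * (t₀ - x) = -Y := by linear_combination ht₀ + hch
    have h' : s * (t₀ - x) < 0 := by rw [h]; linarith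
    exact neg_of_mul_neg_right h' hs.le
  have hft₀ : 0 < f t₀ := hfpos _ (by linarith)
  have hfac := upperReg_cubic_factor (hy₁.trans (hf x₁)) hM hch t₀
  have hprod : 0 < 4 * (t₀ - x₁) * (t₀ - x) * (t₀ - (s ^ 2 / 4 - x - x₁)) := by
    rw [← hfac, hline, ← hf]; simpa using hft₀
  have h3 : t₀ < s ^ 2 / 4 - x - x₁ := by
    refine lt_of_not_ge fun hcon => ?_
    have h12 : 4 * (t₀ - x₁) * (t₀ - x) < 0 := by nlinarith
    have : 4 * (t₀ - x₁) * (t₀ - x) * (t₀ - (s ^ 2 / 4 - x - x₁)) ≤ 0 :=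
      mul_nonpos_iff.2 (Or.inr ⟨h12.le, sub_nonneg.2 hcon⟩)
    linarith
  refine ⟨by linarith, ?_⟩
  have e1 : Y + s * (s ^ 2 / 4 - x - x₁ - x) = s * ((s ^ 2 / 4 - x - x₁) - t₀) := by
    linear_combination hch + ht₀
  rw [e1]
  exact mul_pos hs (sub_pos.2 h3)

/-- **`M > 0` on the identity component.** If `f(e₁) = 0`, `f > 0` on `(e₁, ∞)`, `0 < e₁ < x₁`, then
`M(x) = 4x² + 4xx₁ + 4x₁² − g₂ > 0` for every `x > e₁`: `f(x) = (x − e₁)q(x)` forces `q(x) > 0`, and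
`M(x) − q(x) = 4(x₁ − e₁)(x + x₁ + e₁) > 0`. [cite: SilvermanAEC2009, III.2.3] -/
theorem upperReg_M_pos {g₂ g₃ e₁ x₁ : ℝ} {f : ℝ → ℝ} (hf : ∀ t, f t = 4 * t ^ 3 - g₂ * t - g₃)
    (hfe₁ : f e₁ = 0) (he₁ : 0 < e₁) (hfpos : ∀ t, e₁ < t → 0 < f t) (hx₁ : e₁ < x₁) {x : ℝ}
    (hx : e₁ < x) : 0 < 4 * x ^ 2 + 4 * x * x₁ + 4 * x₁ ^ 2 - g₂ := by
  have hq : 0 < 4 * x ^ 2 + 4 * x * e₁ + 4 * e₁ ^ 2 - g₂ := by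
    have hprod : 0 < (x - e₁) * (4 * x ^ 2 + 4 * x * e₁ + 4 * e₁ ^ 2 - g₂) := by
      have h : (x - e₁) * (4 * x ^ 2 + 4 * x * e₁ + 4 * e₁ ^ 2 - g₂) = f x - f e₁ := by
        rw [hf, hf]; ring
      rw [h, hfe₁, sub_zero]
      exact hfpos x hx
    exact pos_of_mul_pos_right hprod (sub_pos.2 hx).le
  nlinarith [mul_pos (sub_pos.2 hx₁) (by linarith : 0 < x + x₁ + e₁)]

/-- **The third abscissa of a chord of two identity-component points is `≥ e₁`.** With `f(e₁) = 0`,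
`e₁ < x₁`, `e₁ < X` and a regular-form chord of slope `s` through `(x₁, y₁)` and `(X, Y)`:
`e₁ ≤ s²/4 − X − x₁` (evaluate `upperReg_cubic_factor` at `e₁`: `−ℓ(e₁)² = 4(e₁ − x₁)(e₁ − X)(e₁ − X′)`).
[cite: SilvermanAEC2009, III.2.3] -/
theorem upperReg_third_ge {g₂ g₃ e₁ x₁ y₁ X Y s : ℝ} (hfe₁ : 4 * e₁ ^ 3 - g₂ * e₁ - g₃ = 0)
    (hx₁ : e₁ < x₁) (hX : e₁ < X) (hy₁ : y₁ ^ 2 = 4 * x₁ ^ 3 - g₂ * x₁ - g₃)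
    (hM : s * (Y + y₁) = 4 * X ^ 2 + 4 * X * x₁ + 4 * x₁ ^ 2 - g₂) (hch : Y - y₁ = s * (X - x₁)) :
    e₁ ≤ s ^ 2 / 4 - X - x₁ := by
  have hfac := upperReg_cubic_factor hy₁ hM hch e₁
  rw [hfe₁] at hfac
  refine le_of_not_gt fun hcon => ?_
  have h12 : 0 < 4 * (e₁ - x₁) * (e₁ - X) :=
    mul_pos_of_neg_of_neg (mul_neg_of_pos_of_neg four_pos (sub_neg.2 hx₁)) (sub_neg.2 hX)
  have h3 : 0 < 4 * (e₁ - x₁) * (e₁ - X) * (e₁ - (s ^ 2 / 4 - X - x₁)) :=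
    mul_pos h12 (sub_pos.2 hcon)
  linarith only [hfac, h3, sq_nonneg (y₁ + s * (e₁ - x₁))]

/-- **`Pg ≠ 0` to the right of `x₂`** from the norm identity `A² − B²f = −4(x − x₂)M²` (`Pg = A + BY`,
`Y² = f(x)`, `M(x) > 0`, `x > x₂`). [cite: Lang1983, Ch. 13 Thm 1.1] -/
theorem upperReg_Pg_ne {x x₁ x₂ y₁ L₁ g₂ Y fx : ℝ} (hY2 : Y ^ 2 = fx)
    (hM : 0 < 4 * x ^ 2 + 4 * x * x₁ + 4 * x₁ ^ 2 - g₂) (hx : x₂ < x)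
    (hnorm : (4 * (x + 2 * x₁) * y₁ - L₁ * (4 * x ^ 2 + 4 * x * x₁ + 4 * x₁ ^ 2 - g₂)) ^ 2
        - (4 * (x + 2 * x₁)) ^ 2 * fx
      = -4 * (x - x₂) * (4 * x ^ 2 + 4 * x * x₁ + 4 * x₁ ^ 2 - g₂) ^ 2) :
    4 * (x + 2 * x₁) * y₁ - L₁ * (4 * x ^ 2 + 4 * x * x₁ + 4 * x₁ ^ 2 - g₂)
      + 4 * (x + 2 * x₁) * Y ≠ 0 := by
  intro h0
  have hA : 4 * (x + 2 * x₁) * y₁ - L₁ * (4 * x ^ 2 + 4 * x * x₁ + 4 * x₁ ^ 2 - g₂)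
      = -(4 * (x + 2 * x₁) * Y) := by linear_combination h0
  have h1 : -4 * (x - x₂) * (4 * x ^ 2 + 4 * x * x₁ + 4 * x₁ ^ 2 - g₂) ^ 2 = 0 := by
    rw [← hnorm, hA]
    linear_combination (4 * (x + 2 * x₁)) ^ 2 * hY2
  have h2 : 0 < 4 * (x - x₂) * (4 * x ^ 2 + 4 * x * x₁ + 4 * x₁ ^ 2 - g₂) ^ 2 :=
    mul_pos (mul_pos four_pos (sub_pos.2 hx)) (pow_pos hM 2)
  linarith only [h1, h2]

/-! ### The per-point package on `(x₁, ∞)` -/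

/-- **Per-point facts on the upper branch right of `x₁`.** For `x > x₁`: `f(x) > 0`, `ybp x = √f(x) > 0`,
`√f + y₁ > 0` (as `f` increases past `x₁`: `f(x) − f(x₁) = (x − x₁)M(x)`, `M > 0`), the regular-form
chord relations, `slp > 0`, `x₁ < τp x`, `Y3p x < 0` (sign lemma) and `Y3p = −√f∘τp` (on-curve identity).
[cite: SilvermanAEC2009, III.2.3] -/
theorem upperReg_key {g₂ g₃ e₁ x₁ y₁ : ℝ} {f ybp slp τp Y3p : ℝ → ℝ}
    (hf : ∀ x, f x = 4 * x ^ 3 - g₂ * x - g₃) (hfe₁ : f e₁ = 0) (he₁ : 0 < e₁)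
    (hfpos : ∀ x, e₁ < x → 0 < f x) (hx₁ : e₁ < x₁) (hy₁ : y₁ ^ 2 = f x₁) (hy₁neg : y₁ < 0)
    (hybp : ybp = fun x => Real.sqrt (f x))
    (hslp : slp = fun x => (4 * x ^ 2 + 4 * x * x₁ + 4 * x₁ ^ 2 - g₂) / (ybp x + y₁))
    (hτp : τp = fun x => slp x ^ 2 / 4 - x - x₁)
    (hY3p : Y3p = fun x => -(ybp x + slp x * (τp x - x))) {x : ℝ} (hx : x₁ < x) :
    0 < f x ∧ ybp x = Real.sqrt (f x) ∧ 0 < ybp x ∧ 0 < ybp x + y₁ ∧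
      slp x * (ybp x + y₁) = 4 * x ^ 2 + 4 * x * x₁ + 4 * x₁ ^ 2 - g₂ ∧
      ybp x - y₁ = slp x * (x - x₁) ∧ 0 < slp x ∧ x₁ < τp x ∧ Y3p x < 0 ∧
      Y3p x = -Real.sqrt (f (τp x)) := by
  have hyb1 : ybp = fun x => 1 * Real.sqrt (f x) := by rw [hybp]; simp
  have hMpos : ∀ t, e₁ < t → 0 < 4 * t ^ 2 + 4 * t * x₁ + 4 * x₁ ^ 2 - g₂ := fun t ht =>
    upperReg_M_pos hf hfe₁ he₁ hfpos hx₁ ht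
  have hxe : e₁ < x := hx₁.trans hx
  have hfx : 0 < f x := hfpos x hxe
  have hYx : ybp x = Real.sqrt (f x) := by rw [hybp]
  have hYpos : 0 < ybp x := by rw [hYx]; exact Real.sqrt_pos.2 hfx
  have hfx₁ : f x₁ < f x := by
    have h : f x - f x₁ = (x - x₁) * (4 * x ^ 2 + 4 * x * x₁ + 4 * x₁ ^ 2 - g₂) := by
      rw [hf, hf]; ring
    have h' := mul_pos (sub_pos.2 hx) (hMpos x hxe)
    rw [← h] at h'
    exact sub_pos.1 h'
  have hD : 0 < ybp x + y₁ := by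
    have h : Real.sqrt (f x₁) < Real.sqrt (f x) :=
      Real.sqrt_lt_sqrt (by rw [← hy₁]; exact sq_nonneg y₁) hfx₁
    rw [← hy₁, Real.sqrt_sq_eq_abs, abs_of_neg hy₁neg, ← hYx] at h
    linarith only [h]
  obtain ⟨hY2, -, hM, hch, -, -⟩ :=
    translCalc_pointFacts hf hy₁ (Or.inl rfl) hyb1 hslp hτp hY3p hfx hD.ne'
  have hs : 0 < slp x := by
    have h : slp x = (4 * x ^ 2 + 4 * x * x₁ + 4 * x₁ ^ 2 - g₂) / (ybp x + y₁) := by rw [hslp]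
    rw [h]
    exact div_pos (hMpos x hxe) hD
  obtain ⟨hτgt, hline⟩ := upperReg_sign hf hfpos hx₁ hy₁ hy₁neg hYpos hs hM hch
  have hτx : τp x = slp x ^ 2 / 4 - x - x₁ := by rw [hτp]
  have hY3x : Y3p x = -(ybp x + slp x * (τp x - x)) := by rw [hY3p]
  have hY3neg : Y3p x < 0 := by rw [hY3x, hτx]; exact neg_lt_zero.2 hline
  have hon : Y3p x ^ 2 = f (τp x) := by
    rw [hY3x, hτx, hf]
    exact translCalc_onCurve (hY2.trans (hf x)) hch hM
  have hY3eq : Y3p x = -Real.sqrt (f (τp x)) := by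
    rw [← hon, Real.sqrt_sq_eq_abs, abs_of_neg hY3neg, neg_neg]
  refine ⟨hfx, hYx, hYpos, hD, hM, hch, hs, ?_, hY3neg, hY3eq⟩
  rw [hτx]
  exact hτgt

/-- **Boundedness of the potential near `x₁`.** `Qfp` is bounded on `(x₁, x₁ + 1]`: it agrees there with
the regularised function `2D(Mx − √f·D)/(M² − 4(x + x₁)D²) − √f/(2x)` (`D = √f + y₁`,
`upperReg_regularised`), which is continuous on the compact interval `[x₁, x₁ + 1]` because its
denominator is `4D²τp > 0` on `(x₁, ∞)` and `M(x₁)² > 0` at `x₁`. [cite: SilvermanAEC2009, III.2.3] -/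
theorem upperReg_bounded {g₂ g₃ e₁ x₁ y₁ : ℝ} {f ybp slp τp Y3p Qfp : ℝ → ℝ}
    (hf : ∀ x, f x = 4 * x ^ 3 - g₂ * x - g₃) (hfe₁ : f e₁ = 0) (he₁ : 0 < e₁)
    (hfpos : ∀ x, e₁ < x → 0 < f x) (hx₁ : e₁ < x₁) (hy₁ : y₁ ^ 2 = f x₁) (hy₁neg : y₁ < 0)
    (hybp : ybp = fun x => Real.sqrt (f x))
    (hslp : slp = fun x => (4 * x ^ 2 + 4 * x * x₁ + 4 * x₁ ^ 2 - g₂) / (ybp x + y₁))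
    (hτp : τp = fun x => slp x ^ 2 / 4 - x - x₁)
    (hY3p : Y3p = fun x => -(ybp x + slp x * (τp x - x)))
    (hQfp : Qfp = fun x => slp x / 2 + Y3p x / (2 * τp x) - ybp x / (2 * x)) :
    ∃ Mb : ℝ, ∀ x ∈ Set.Ioc x₁ (x₁ + 1), |Qfp x| ≤ Mb := by
  have key := fun t (ht : x₁ < t) =>
    upperReg_key hf hfe₁ he₁ hfpos hx₁ hy₁ hy₁neg hybp hslp hτp hY3p ht
  have hsqx₁ : Real.sqrt (f x₁) = -y₁ := by rw [← hy₁, Real.sqrt_sq_eq_abs, abs_of_neg hy₁neg]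
  have hfc : Continuous f := by
    rw [show f = fun t => 4 * t ^ 3 - g₂ * t - g₃ from funext hf]
    fun_prop
  obtain ⟨R, hR⟩ : ∃ R : ℝ → ℝ, R = fun t => 2 * (Real.sqrt (f t) + y₁)
      * ((4 * t ^ 2 + 4 * t * x₁ + 4 * x₁ ^ 2 - g₂) * t - Real.sqrt (f t) * (Real.sqrt (f t) + y₁))
      / ((4 * t ^ 2 + 4 * t * x₁ + 4 * x₁ ^ 2 - g₂) ^ 2
        - 4 * (t + x₁) * (Real.sqrt (f t) + y₁) ^ 2)
      - Real.sqrt (f t) / (2 * t) := ⟨_, rfl⟩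
  have hden : ∀ t ∈ Icc x₁ (x₁ + 1), (4 * t ^ 2 + 4 * t * x₁ + 4 * x₁ ^ 2 - g₂) ^ 2
      - 4 * (t + x₁) * (Real.sqrt (f t) + y₁) ^ 2 ≠ 0 := by
    intro t ht
    rcases eq_or_lt_of_le ht.1 with h | h
    · rw [← h, hsqx₁, neg_add_cancel, zero_pow two_ne_zero, mul_zero, sub_zero]
      exact pow_ne_zero 2 (upperReg_M_pos hf hfe₁ he₁ hfpos hx₁ hx₁).ne'
    · obtain ⟨-, hYx, -, hD, hM, -, -, hτgt, -, -⟩ := key t h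
      have hτpos : 0 < τp t := (he₁.trans hx₁).trans hτgt
      have hτx : τp t = slp t ^ 2 / 4 - t - x₁ := by rw [hτp]
      have e : (4 * t ^ 2 + 4 * t * x₁ + 4 * x₁ ^ 2 - g₂) ^ 2
          - 4 * (t + x₁) * (ybp t + y₁) ^ 2 = 4 * (ybp t + y₁) ^ 2 * τp t := by
        rw [hτx, ← hM]; ring
      rw [← hYx, e]
      exact (mul_pos (mul_pos four_pos (pow_pos hD 2)) hτpos).ne'
  have hRc : ContinuousOn R (Icc x₁ (x₁ + 1)) := by
    rw [hR]
    refine ContinuousOn.sub (ContinuousOn.div (Continuous.continuousOn (by fun_prop))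
      (Continuous.continuousOn (by fun_prop)) hden)
      (ContinuousOn.div (Continuous.continuousOn (by fun_prop))
        (Continuous.continuousOn (by fun_prop)) fun t ht => ?_)
    have : 0 < t := (he₁.trans hx₁).trans_le ht.1
    positivity
  obtain ⟨C, hC⟩ := isCompact_Icc.exists_bound_of_continuousOn hRc
  refine ⟨C, fun x hx => ?_⟩
  obtain ⟨-, hYx, -, hD, hM, -, -, hτgt, -, -⟩ := key x hx.1
  have hτpos : 0 < τp x := (he₁.trans hx₁).trans hτgt
  have h3 : τp x = slp x ^ 2 / 4 - x - x₁ := by rw [hτp]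
  have hQx : Qfp x = R x := by
    have h1 : Qfp x = slp x / 2 + Y3p x / (2 * τp x) - ybp x / (2 * x) := by rw [hQfp]
    have h2 : Y3p x = -(ybp x + slp x * (τp x - x)) := by rw [hY3p]
    have hτne : slp x ^ 2 / 4 - x - x₁ ≠ 0 := by rw [← h3]; exact hτpos.ne'
    rw [h1, h2, h3, hR]
    simp only [← hYx]
    rw [upperReg_regularised hD.ne' hM.symm hτne]
  have hb := hC x (Ioc_subset_Icc_self hx)
  rw [Real.norm_eq_abs, ← hQx] at hb
  exact hb

/-- **`ℚ`-semialgebraicity of the upper-branch functions** on any `ℚ`-semialgebraic `S ⊆ ℝ¹` (algebraic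
constants; closure under `+, −, ×`, junk-tolerant division `cornerUp_fun_div`, and `√`).
[cite: BochnakCosteRoy1998, Prop. 2.2.6] -/
theorem upperReg_semialg {g₂ g₃ x₁ y₁ L₁ : ℝ}
    {f ybp slp τp Y3p Qfp sl3p X33p Y33p Qf3p Pgp Gp τp' : ℝ → ℝ}
    (hf : ∀ x, f x = 4 * x ^ 3 - g₂ * x - g₃) (hL₁ : L₁ = (12 * x₁ ^ 2 - g₂) / (2 * y₁))
    (ag₂ : IsAlgebraic ℚ g₂) (ag₃ : IsAlgebraic ℚ g₃) (ax₁ : IsAlgebraic ℚ x₁) (ay₁ : IsAlgebraic ℚ y₁)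
    (hybp : ybp = fun x => Real.sqrt (f x))
    (hslp : slp = fun x => (4 * x ^ 2 + 4 * x * x₁ + 4 * x₁ ^ 2 - g₂) / (ybp x + y₁))
    (hτp : τp = fun x => slp x ^ 2 / 4 - x - x₁)
    (hY3p : Y3p = fun x => -(ybp x + slp x * (τp x - x)))
    (hQfp : Qfp = fun x => slp x / 2 + Y3p x / (2 * τp x) - ybp x / (2 * x))
    (hsl3p : sl3p = fun x => (4 * τp x ^ 2 + 4 * τp x * x₁ + 4 * x₁ ^ 2 - g₂) / (Y3p x + y₁))
    (hX33p : X33p = fun x => sl3p x ^ 2 / 4 - τp x - x₁)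
    (hY33p : Y33p = fun x => -(Y3p x + sl3p x * (X33p x - τp x)))
    (hQf3p : Qf3p = fun x => sl3p x / 2 + Y33p x / (2 * X33p x) - Y3p x / (2 * τp x))
    (hPgp : Pgp = fun x => 4 * (x + 2 * x₁) * y₁ - L₁ * (4 * x ^ 2 + 4 * x * x₁ + 4 * x₁ ^ 2 - g₂)
      + 4 * (x + 2 * x₁) * ybp x)
    (hGp : Gp = fun x => Pgp x / (ybp x + y₁) ^ 2 * Real.sqrt (x * X33p x) / τp x)
    (hτp' : τp' = fun x => Y3p x / ybp x)
    {S : Set ℝ} (hS : IsSemialgebraic ℚ {t : Fin 1 → ℝ | t 0 ∈ S}) :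
    IsSemialgebraicFunOn ℚ {t : Fin 1 → ℝ | t 0 ∈ S} (fun t => τp (t 0)) ∧
      IsSemialgebraicFunOn ℚ {t : Fin 1 → ℝ | t 0 ∈ S} (fun t => Y3p (t 0)) ∧
      IsSemialgebraicFunOn ℚ {t : Fin 1 → ℝ | t 0 ∈ S} (fun t => Qfp (t 0)) ∧
      IsSemialgebraicFunOn ℚ {t : Fin 1 → ℝ | t 0 ∈ S} (fun t => Qf3p (t 0)) ∧
      IsSemialgebraicFunOn ℚ {t : Fin 1 → ℝ | t 0 ∈ S} (fun t => Gp (t 0)) ∧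
      IsSemialgebraicFunOn ℚ {t : Fin 1 → ℝ | t 0 ∈ S} (fun t => ybp (t 0)) ∧
      IsSemialgebraicFunOn ℚ {t : Fin 1 → ℝ | t 0 ∈ S} (fun t => τp' (t 0)) := by
  have hX : IsSemialgebraicFunOn ℚ {t : Fin 1 → ℝ | t 0 ∈ S} (fun t => t 0) :=
    (isSemialgebraicFunOn_aeval hS (X 0)).congr fun x _ => by simp
  have c {a : ℝ} (ha : IsAlgebraic ℚ a) : IsSemialgebraicFunOn ℚ {t : Fin 1 → ℝ | t 0 ∈ S}
      (fun _ => a) := isSemialgebraicFunOn_const_of_isAlgebraic hS ha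
  have n (k : ℕ) [k.AtLeastTwo] :
      IsSemialgebraicFunOn ℚ {t : Fin 1 → ℝ | t 0 ∈ S} (fun _ => (OfNat.ofNat k : ℝ)) :=
    isSemialgebraicFunOn_const_ofNat hS k
  have sY : IsSemialgebraicFunOn ℚ {t : Fin 1 → ℝ | t 0 ∈ S} (fun t => ybp (t 0)) :=
    (isSemialgebraicFunOn_sqrt_cubic_apply hS ag₂ ag₃ hf 0).congr fun t _ => by rw [hybp]
  have sM : IsSemialgebraicFunOn ℚ {t : Fin 1 → ℝ | t 0 ∈ S}
      (fun t => 4 * t 0 ^ 2 + 4 * t 0 * x₁ + 4 * x₁ ^ 2 - g₂) :=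
    isSemialgebraicFunOn_chordM_apply hS ag₂ ax₁ 0
  have sS : IsSemialgebraicFunOn ℚ {t : Fin 1 → ℝ | t 0 ∈ S} (fun t => slp (t 0)) :=
    (cornerUp_fun_div sM (sY.fun_add (c ay₁))).congr fun t _ => by rw [hslp]
  have sτ : IsSemialgebraicFunOn ℚ {t : Fin 1 → ℝ | t 0 ∈ S} (fun t => τp (t 0)) :=
    (((cornerUp_fun_div (sS.fun_pow 2) (n 4)).fun_sub hX).fun_sub (c ax₁)).congr
      fun t _ => by rw [hτp]
  have sY3 : IsSemialgebraicFunOn ℚ {t : Fin 1 → ℝ | t 0 ∈ S} (fun t => Y3p (t 0)) :=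
    (sY.fun_add (sS.fun_mul (sτ.fun_sub hX))).fun_neg.congr fun t _ => by rw [hY3p]
  have sQ : IsSemialgebraicFunOn ℚ {t : Fin 1 → ℝ | t 0 ∈ S} (fun t => Qfp (t 0)) :=
    (((cornerUp_fun_div sS (n 2)).fun_add (cornerUp_fun_div sY3 ((n 2).fun_mul sτ))).fun_sub
      (cornerUp_fun_div sY ((n 2).fun_mul hX))).congr fun t _ => by rw [hQfp]
  have sM3 : IsSemialgebraicFunOn ℚ {t : Fin 1 → ℝ | t 0 ∈ S}
      (fun t => 4 * τp (t 0) ^ 2 + 4 * τp (t 0) * x₁ + 4 * x₁ ^ 2 - g₂) :=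
    ((((n 4).fun_mul (sτ.fun_pow 2)).fun_add (((n 4).fun_mul sτ).fun_mul (c ax₁))).fun_add
      ((n 4).fun_mul ((c ax₁).fun_pow 2))).fun_sub (c ag₂)
  have sS3 : IsSemialgebraicFunOn ℚ {t : Fin 1 → ℝ | t 0 ∈ S} (fun t => sl3p (t 0)) :=
    (cornerUp_fun_div sM3 (sY3.fun_add (c ay₁))).congr fun t _ => by rw [hsl3p]
  have sX33 : IsSemialgebraicFunOn ℚ {t : Fin 1 → ℝ | t 0 ∈ S} (fun t => X33p (t 0)) :=
    (((cornerUp_fun_div (sS3.fun_pow 2) (n 4)).fun_sub sτ).fun_sub (c ax₁)).congr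
      fun t _ => by rw [hX33p]
  have sY33 : IsSemialgebraicFunOn ℚ {t : Fin 1 → ℝ | t 0 ∈ S} (fun t => Y33p (t 0)) :=
    (sY3.fun_add (sS3.fun_mul (sX33.fun_sub sτ))).fun_neg.congr fun t _ => by rw [hY33p]
  have sQ3 : IsSemialgebraicFunOn ℚ {t : Fin 1 → ℝ | t 0 ∈ S} (fun t => Qf3p (t 0)) :=
    (((cornerUp_fun_div sS3 (n 2)).fun_add (cornerUp_fun_div sY33 ((n 2).fun_mul sX33))).fun_sub
      (cornerUp_fun_div sY3 ((n 2).fun_mul sτ))).congr fun t _ => by rw [hQf3p]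
  have cL : IsSemialgebraicFunOn ℚ {t : Fin 1 → ℝ | t 0 ∈ S} (fun _ => L₁) :=
    (cornerUp_fun_div (((n 12).fun_mul ((c ax₁).fun_pow 2)).fun_sub (c ag₂))
      ((n 2).fun_mul (c ay₁))).congr fun _ _ => by rw [hL₁]
  have sP : IsSemialgebraicFunOn ℚ {t : Fin 1 → ℝ | t 0 ∈ S} (fun t => Pgp (t 0)) :=
    (((((n 4).fun_mul (hX.fun_add ((n 2).fun_mul (c ax₁)))).fun_mul (c ay₁)).fun_sub
      (cL.fun_mul sM)).fun_add
      (((n 4).fun_mul (hX.fun_add ((n 2).fun_mul (c ax₁)))).fun_mul sY)).congr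
      fun t _ => by rw [hPgp]
  have sG : IsSemialgebraicFunOn ℚ {t : Fin 1 → ℝ | t 0 ∈ S} (fun t => Gp (t 0)) :=
    (cornerUp_fun_div ((cornerUp_fun_div sP ((sY.fun_add (c ay₁)).fun_pow 2)).fun_mul
      (hX.fun_mul sX33).fun_sqrt) sτ).congr fun t _ => by rw [hGp]
  have sτ' : IsSemialgebraicFunOn ℚ {t : Fin 1 → ℝ | t 0 ∈ S} (fun t => τp' (t 0)) :=
    (cornerUp_fun_div sY3 sY).congr fun t _ => by rw [hτp']
  exact ⟨sτ, sY3, sQ, sQ3, sG, sY, sτ'⟩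

end Summit.KontsevichZagierPeriods.KontsevichZagierPeriods.Cruxes.NeronTorsionSector.Translation

end
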